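import Summits.Ventures.Crystal3D.Kissing125.SearchCheck3
import HarnessLib

/-!
# The run of the growth search at `κ = 7/32`, part 28 of 256 (computational, `native_decide`)

HONEST FRAMING (cell pub-crystal3d, K-path at `h = 5/4`): this is NOT a result printed by Hales.  It is his
METHOD (arXiv:1209.6043, Theorem 3: the main estimate + the classification of the contact graphs of kissing
configurations, in the tree's form of a verified interval-arithmetic growth search, `Literature/…/KissingSearch*.lean`)
RE-RUN at the separation `5/2` instead of `2h₀ = 2.52` (largest long-side cosine `κ = 1 − (5/4)²/2 = 7/32` instead of
`κ₀ = 1031/5000`).  The declarations are namespace-shadowing COPIES of the tree's declarations (same names, inside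
`namespace Summit.Ventures.Crystal3D.Kissing125[.KissingSearch]`, original docstrings and citation tags kept — the tags
name the printed METHOD step each declaration implements); the diff to the originals is stated per file.  Generated by
`HOME/lean/kissing125/gen/mkfiles.py`; audit recipe in `HOME/lean/kissing125/README.md`.  Nothing here is asserted
about GAP(1.26) or any census.

THIS FILE: part `28` of the computation `∀ i < 256, checkPart 5 256 i 60 = true` for the 7/32 checker
(`SearchCheck*.lean`): the states of the depth-`5` frontier (`21 802` states at `7/32`; `17 556` in the tree's 128-part run
at `κ₀`) with index `≡ 28 (mod 256)`, each searched with fuel `60` — `256` parts so that a part carries about the node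
count of a `κ₀` part of the tree's run (the 7/32 search has ≈ `2.05×` the nodes; pilot measurement by typer-bulk g6, farm
`#eval` of a counting twin: every leaf killed by propagation or accepted as FCC/HCP, no bisection needed).  Assembled in `SearchFinal.lean`.

## References
* T. C. Hales, *A proof of Fejes Tóth's conjecture on sphere packings with kissing number twelve*,
  arXiv:1209.6043 (2012): Definition 1, Theorem 2 (main estimate `d₃`), Theorem 3, Lemmas 7–10. [`Hales2012`]
* R. E. Moore, *Interval Analysis* (1966), Theorem 3.1, §4.4. [`Moore1966`]
-/

namespace Summit.Ventures.Crystal3D.Kissing125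

open Literature.Geometry.DiscreteGeometry

namespace KissingSearch

/-- **Part `28` of `256` of the growth search at `κ = 7/32` returns `true`** (frontier depth `5`, fuel `60`).
[cite: Hales2012, Theorem 3 and Lemma 8] -/
theorem checkPart_eq_true_028 : checkPart 5 256 28 60 = true := by
  native_decide

end KissingSearch

end Summit.Ventures.Crystal3D.Kissing125


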